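import Summits.Ventures.PercRepro.C041CutSplitSum
import Summits.Ventures.PercRepro.C041CutGlueCS

/-!
# LEMMA G-CS ON ZONE PORT PROBLEMS WITH A CUT VERTEX — the counts of a loose problem are the glue's counts
(p6, gen 28; C-041.md §17 (b) on the graph side, the (CS) form of gen 25's `phiOr_eq_glue`)

Setting of `C041CutSplitSum` (a split `sp` of a loose problem `L` at a cut vertex: the gadget space `sp.gadget`
and the far space `sp.far`, the patterns of `L` = the pairs of side patterns, `splitEquiv`) and `C041CutGlueCS`.
The three COUNTS of `L` — `nValidOr` (admissible with a red terminal edge), `nGood₁`, `nGood₂` (admissible with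
`Good_t`; `Good_t` implies validity) — are the glue's `NV`, `cnt G₁`, `cnt G₂` (`nValidOr_eq_glue`,
`nGood₁_eq_glue`, `nGood₂_eq_glue`: the same pairing as `phiOr_eq_glue`, the weight of a pair being `[Adm]`), so
(CS) for `L` (`CSOrZ L`) is (CS) for the glue (`csOrZ_iff_glue`), and LEMMA G-CS transfers:

* **`csOrZ_of_split`** — (CS) for the gadget side and for the far side, with (INV) on the gadget side, give (CS)
  for every loose zone port problem with a cut vertex — in particular for every LAYER of an O-cube.
-/

namespace PercRepro

namespace ZonePort

namespace Loose

open Finset CutGlue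

variable {V E : Type*}

section Counts

variable (L : Loose V E) [Fintype E] [DecidableEq E] [DecidableEq V]

open Classical in
/-- The number of admissible patterns with a red terminal edge (`V_∨`). -/
noncomputable def nValidOr : ℤ := ∑ x : L.Term → Bool, if L.Adm x ∧ (L.X₁ x ∨ L.X₂ x) then 1 else 0

open Classical in
/-- The number of admissible patterns with `Good₁`. -/
noncomputable def nGood₁ : ℤ := ∑ x : L.Term → Bool, if L.Adm x ∧ L.Good₁ x then 1 else 0

open Classical in
/-- The number of admissible patterns with `Good₂`. -/
noncomputable def nGood₂ : ℤ := ∑ x : L.Term → Bool, if L.Adm x ∧ L.Good₂ x then 1 else 0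

/-- **CONJECTURE (CS) on a loose zone port problem** (validity `V_∨`): `(max (#valid − #Good₁ − #Good₂) 0)² ≤
#Good₁ · #Good₂`. -/
def CSOrZ : Prop := CSInt L.nValidOr L.nGood₁ L.nGood₂

end Counts

namespace Split

variable {L : Loose V E} (sp : L.Split) [Fintype E] [DecidableEq E] [DecidableEq V]

omit [Fintype E] [DecidableEq E] [DecidableEq V] in
open Classical in
/-- The weight of a pair in the glue is the admissibility indicator of the pattern. -/
theorem glue_w_eq (x : L.Term → Bool) :
    (((glue sp.gadget sp.ρ₁ sp.ρ₂ sp.far).w (sp.res₁ x, sp.res₂ x) : ℕ) : ℤ) = if L.Adm x then 1 else 0 := by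
  have hw : (glue sp.gadget sp.ρ₁ sp.ρ₂ sp.far).w (sp.res₁ x, sp.res₂ x)
      = (if sp.Adm₁ (sp.res₁ x) then 1 else 0) * (if sp.Adm₂ (sp.res₂ x) then 1 else 0) := rfl
  rw [hw]
  by_cases hA : L.Adm x
  · have hA' := (sp.adm_iff x).1 hA
    rw [if_pos hA'.1, if_pos hA'.2, if_pos hA]
    norm_num
  · rw [if_neg hA]
    by_cases h1 : sp.Adm₁ (sp.res₁ x)
    · have h2 : ¬ sp.Adm₂ (sp.res₂ x) := fun h2 => hA ((sp.adm_iff x).2 ⟨h1, h2⟩)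
      rw [if_neg h2, mul_zero, Nat.cast_zero]
    · rw [if_neg h1, zero_mul, Nat.cast_zero]

omit [Fintype E] [DecidableEq E] [DecidableEq V] in
/-- Validity of a pair in the glue is `X₁ ∨ X₂`. -/
theorem glue_V_iff (x : L.Term → Bool) :
    (glue sp.gadget sp.ρ₁ sp.ρ₂ sp.far).V (sp.res₁ x, sp.res₂ x) ↔ L.X₁ x ∨ L.X₂ x := by
  rw [glue_V, sp.X₁_iff, sp.X₂_iff]
  show (sp.X₁' (sp.res₁ x) ∨ sp.X₂' (sp.res₁ x)) ∨ (sp.X₁'' (sp.res₂ x) ∨ sp.X₂'' (sp.res₂ x)) ↔ _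
  tauto

open Classical in
/-- **The valid count is the glue's `NV`.** -/
theorem nValidOr_eq_glue : L.nValidOr = (glue sp.gadget sp.ρ₁ sp.ρ₂ sp.far).NV := by
  unfold Loose.nValidOr Space.NV Space.cnt
  refine Fintype.sum_equiv sp.splitEquiv _ _ fun x => ?_
  show (if L.Adm x ∧ (L.X₁ x ∨ L.X₂ x) then (1 : ℤ) else 0)
    = if (glue sp.gadget sp.ρ₁ sp.ρ₂ sp.far).V (sp.res₁ x, sp.res₂ x) then
        (((glue sp.gadget sp.ρ₁ sp.ρ₂ sp.far).w (sp.res₁ x, sp.res₂ x) : ℕ) : ℤ) else 0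
  rw [sp.glue_w_eq x]
  by_cases hX : L.X₁ x ∨ L.X₂ x
  · rw [if_pos ((sp.glue_V_iff x).2 hX)]
    by_cases hA : L.Adm x
    · rw [if_pos ⟨hA, hX⟩, if_pos hA]
    · rw [if_neg (fun h => hA h.1), if_neg hA]
  · rw [if_neg (fun h => hX (sp.glue_V_iff x |>.1 h)), if_neg (fun h => hX h.2)]

open Classical in
/-- **The `Good₁` count is the glue's `cnt G₁`.** -/
theorem nGood₁_eq_glue :
    L.nGood₁ = (glue sp.gadget sp.ρ₁ sp.ρ₂ sp.far).cnt (glue sp.gadget sp.ρ₁ sp.ρ₂ sp.far).G₁ := by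
  unfold Loose.nGood₁ Space.cnt
  refine Fintype.sum_equiv sp.splitEquiv _ _ fun x => ?_
  show (if L.Adm x ∧ L.Good₁ x then (1 : ℤ) else 0)
    = if (glue sp.gadget sp.ρ₁ sp.ρ₂ sp.far).G₁ (sp.res₁ x, sp.res₂ x) then
        (((glue sp.gadget sp.ρ₁ sp.ρ₂ sp.far).w (sp.res₁ x, sp.res₂ x) : ℕ) : ℤ) else 0
  have hG : (glue sp.gadget sp.ρ₁ sp.ρ₂ sp.far).G₁ (sp.res₁ x, sp.res₂ x) ↔ L.Good₁ x := by
    rw [glue_G₁]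
    exact (sp.good₁_iff x).symm
  rw [sp.glue_w_eq x]
  by_cases hg : L.Good₁ x
  · rw [if_pos (hG.2 hg)]
    by_cases hA : L.Adm x
    · rw [if_pos ⟨hA, hg⟩, if_pos hA]
    · rw [if_neg (fun h => hA h.1), if_neg hA]
  · rw [if_neg (fun h => hg (hG.1 h)), if_neg (fun h => hg h.2)]

open Classical in
/-- **The `Good₂` count is the glue's `cnt G₂`.** -/
theorem nGood₂_eq_glue :
    L.nGood₂ = (glue sp.gadget sp.ρ₁ sp.ρ₂ sp.far).cnt (glue sp.gadget sp.ρ₁ sp.ρ₂ sp.far).G₂ := by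
  unfold Loose.nGood₂ Space.cnt
  refine Fintype.sum_equiv sp.splitEquiv _ _ fun x => ?_
  show (if L.Adm x ∧ L.Good₂ x then (1 : ℤ) else 0)
    = if (glue sp.gadget sp.ρ₁ sp.ρ₂ sp.far).G₂ (sp.res₁ x, sp.res₂ x) then
        (((glue sp.gadget sp.ρ₁ sp.ρ₂ sp.far).w (sp.res₁ x, sp.res₂ x) : ℕ) : ℤ) else 0
  have hG : (glue sp.gadget sp.ρ₁ sp.ρ₂ sp.far).G₂ (sp.res₁ x, sp.res₂ x) ↔ L.Good₂ x := by
    rw [glue_G₂]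
    exact (sp.good₂_iff x).symm
  rw [sp.glue_w_eq x]
  by_cases hg : L.Good₂ x
  · rw [if_pos (hG.2 hg)]
    by_cases hA : L.Adm x
    · rw [if_pos ⟨hA, hg⟩, if_pos hA]
    · rw [if_neg (fun h => hA h.1), if_neg hA]
  · rw [if_neg (fun h => hg (hG.1 h)), if_neg (fun h => hg h.2)]

open Classical in
/-- **(CS) for `L` is (CS) for the glue of its two sides.** -/
theorem csOrZ_iff_glue : L.CSOrZ ↔ (glue sp.gadget sp.ρ₁ sp.ρ₂ sp.far).CSZ := by
  unfold Loose.CSOrZ Space.CSZ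
  rw [sp.nValidOr_eq_glue, sp.nGood₁_eq_glue, sp.nGood₂_eq_glue]

open Classical in
/-- **LEMMA G-CS ON ZONE PORT PROBLEMS WITH A CUT VERTEX** (C-041.md §17 (b), graph side): (CS) for the gadget side
and for the far side, with (INV) on the gadget side (`I ≤ m₁ ρ₁`, `I ≤ m₂ ρ₂`), give (CS) for `L`. -/
theorem csOrZ_of_split (hP : sp.gadget.CSZ) (hQ : sp.far.CSZ) (h₁ : sp.gadget.I ≤ sp.gadget.m₁ sp.ρ₁)
    (h₂ : sp.gadget.I ≤ sp.gadget.m₂ sp.ρ₂) : L.CSOrZ := by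
  rw [sp.csOrZ_iff_glue]
  exact csZ_glue sp.gadget sp.ρ₁ sp.ρ₂ sp.far hP hQ h₁ h₂

end Split

end Loose

end ZonePort

end PercRepro
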